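import Mathlib
import Summits.Ventures.HodgeRepro2.T5PadicFiniteOrderCharacters

/-!
# T5PadicTorsionCharactersInflation — `Ξ_𝔭[p^k]` is the character group of `Γ_𝔭 / Γ_𝔭^{p^k} ≅ ℤ/p^kℤ`

Cell pub-hodge-repro2, Tier 5 support (seat p7; route/T5-CHECK-G-p7.md §3 S5 / S8). The finite-order
characters of `Γ_𝔭 ≅ ℤ_p` of order dividing `p^k` are exactly the characters inflated from the finite
quotient `ℤ_p / p^k ℤ_p = ℤ/p^kℤ` (Mathlib's `toZModPow k`):

* `inflate χ := χ ∘ toZModPow k` is a continuous character with `(inflate χ)^{p^k} = 1`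
  (`continuous_inflate`, `inflate_pow`);
* conversely a continuous character `κ` with `κ^{p^k} = 1` is constant on the cosets of `p^k ℤ_p`, so it
  descends to `ℤ/p^kℤ` (`descend`), and the two constructions are inverse (`inflateEquiv`:
  `AddChar (ZMod (p^k)) R ≃ {κ continuous : κ^{p^k} = 1}`).

Mathlib + T5PadicFiniteOrderCharacters only.
-/

namespace Summit.Ventures.HodgeRepro2.T5PadicTorsionCharactersInflation

open PadicInt Filter Topology
open Summit.Ventures.HodgeRepro2.T5PadicFiniteOrderCharacters

variable {p : ℕ} [hp : Fact p.Prime]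
variable {R : Type*} [Monoid R]

/-- INFLATION: a character of `ℤ/p^kℤ` pulled back to `ℤ_p` along `toZModPow k`. -/
noncomputable def inflate (k : ℕ) (χ : AddChar (ZMod (p ^ k)) R) : AddChar ℤ_[p] R :=
  χ.compAddMonoidHom (toZModPow k : ℤ_[p] →+* ZMod (p ^ k)).toAddMonoidHom

/-- `inflate χ x = χ (x mod p^k)`. -/
@[simp] theorem inflate_apply (k : ℕ) (χ : AddChar (ZMod (p ^ k)) R) (x : ℤ_[p]) :
    inflate k χ x = χ (toZModPow k x) := rfl

omit hp in
/-- `p^k • y = 0` in `ℤ/p^kℤ`. -/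
theorem pow_nsmul_zmod (k : ℕ) (y : ZMod (p ^ k)) : (p ^ k) • y = 0 := by
  rw [nsmul_eq_mul, ZMod.natCast_self, zero_mul]

/-- Every value of an inflated character is a `p^k`-th root of unity. -/
theorem inflate_pow (k : ℕ) (χ : AddChar (ZMod (p ^ k)) R) (x : ℤ_[p]) :
    inflate k χ x ^ (p ^ k) = 1 := by
  rw [inflate_apply, ← AddChar.map_nsmul_eq_pow, pow_nsmul_zmod, AddChar.map_zero_eq_one]

section Topology

variable [TopologicalSpace R]

/-- An inflated character is continuous (locally constant). -/
theorem continuous_inflate (k : ℕ) (χ : AddChar (ZMod (p ^ k)) R) : Continuous (inflate k χ) :=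
  ((isLocallyConstant_toZModPow k).comp χ).continuous

end Topology

/-- A character `κ` with `κ^{p^k} = 1` takes the same value on `n` and on `n mod p^k` (`n ∈ ℕ`). -/
theorem map_natCast_mod (k : ℕ) (κ : AddChar ℤ_[p] R) (hκ : ∀ x : ℤ_[p], κ x ^ (p ^ k) = 1) (n : ℕ) :
    κ ((n % p ^ k : ℕ) : ℤ_[p]) = κ (n : ℤ_[p]) := by
  conv_rhs => rw [← Nat.mod_add_div n (p ^ k)]
  rw [Nat.cast_add, AddChar.map_add_eq_mul, Nat.cast_mul, Nat.cast_pow, map_pow_mul, hκ, mul_one]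

/-- DESCENT: a character `κ` of `ℤ_p` with `κ^{p^k} = 1` descends to `ℤ/p^kℤ` via `y ↦ κ (y.val)`. -/
noncomputable def descend (k : ℕ) (κ : AddChar ℤ_[p] R) (hκ : ∀ x : ℤ_[p], κ x ^ (p ^ k) = 1) :
    AddChar (ZMod (p ^ k)) R where
  toFun y := κ ((y.val : ℕ) : ℤ_[p])
  map_zero_eq_one' := by
    rw [ZMod.val_zero, Nat.cast_zero, AddChar.map_zero_eq_one]
  map_add_eq_mul' a b := by
    rw [ZMod.val_add, map_natCast_mod k κ hκ, Nat.cast_add, AddChar.map_add_eq_mul]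

/-- `descend κ y = κ (y.val)`. -/
@[simp] theorem descend_apply (k : ℕ) (κ : AddChar ℤ_[p] R) (hκ : ∀ x : ℤ_[p], κ x ^ (p ^ k) = 1)
    (y : ZMod (p ^ k)) : descend k κ hκ y = κ ((y.val : ℕ) : ℤ_[p]) := rfl

/-- Descending an inflated character gives it back. -/
theorem descend_inflate (k : ℕ) (χ : AddChar (ZMod (p ^ k)) R) :
    descend k (inflate k χ) (inflate_pow k χ) = χ := by
  ext y
  rw [descend_apply, inflate_apply, map_natCast, ZMod.natCast_zmod_val]

/-- `descend κ` evaluated at `1` is `κ 1` (for every `k`, including `k = 0`). -/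
theorem descend_one (k : ℕ) (κ : AddChar ℤ_[p] R) (hκ : ∀ x : ℤ_[p], κ x ^ (p ^ k) = 1) :
    descend k κ hκ 1 = κ 1 := by
  rw [descend_apply, ZMod.val_one_eq_one_mod, map_natCast_mod k κ hκ, Nat.cast_one]

section Equiv

variable [TopologicalSpace R] [T2Space R]

/-- Inflating a descended continuous character gives it back (both are continuous and agree at `1`). -/
theorem inflate_descend (k : ℕ) (κ : AddChar ℤ_[p] R) (hc : Continuous κ)
    (hκ : ∀ x : ℤ_[p], κ x ^ (p ^ k) = 1) : inflate k (descend k κ hκ) = κ :=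
  eq_of_eval_one_eq (continuous_inflate k _) hc (by
    rw [inflate_apply, map_one, descend_one])

/-- `Ξ_𝔭[p^k] ≃ Hom(ℤ/p^kℤ, R)`: the continuous characters of `ℤ_p` killed by `p^k` are exactly the
characters of the finite quotient `ℤ_p / p^k ℤ_p = ℤ/p^kℤ`. -/
noncomputable def inflateEquiv (k : ℕ) :
    AddChar (ZMod (p ^ k)) R ≃ {κ : AddChar ℤ_[p] R // Continuous κ ∧ ∀ x : ℤ_[p], κ x ^ (p ^ k) = 1}
    where
  toFun χ := ⟨inflate k χ, continuous_inflate k χ, inflate_pow k χ⟩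
  invFun κ := descend k κ.1 κ.2.2
  left_inv χ := descend_inflate k χ
  right_inv κ := by
    apply Subtype.ext
    exact inflate_descend k κ.1 κ.2.1 κ.2.2

/-- `inflateEquiv χ = χ ∘ toZModPow k`. -/
theorem inflateEquiv_apply (k : ℕ) (χ : AddChar (ZMod (p ^ k)) R) :
    (inflateEquiv k χ : AddChar ℤ_[p] R) = inflate k χ := rfl

end Equiv

end Summit.Ventures.HodgeRepro2.T5PadicTorsionCharactersInflation
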